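import Literature.InformationTheory.QuantumCodes.QuantumExpanderCodeParameters
import Literature.InformationTheory.QuantumCodes.SyndromeDecodingCSS
import HarnessLib

/-!
# Quantum expander codes: minimum-weight decoding corrects every error of weight `≤ ⌊min(γ_A n_A, γ_B n_B)⌋ / 2`

Topic `InformationTheory/QuantumCodes`; namespace `Literature.InformationTheory.QuantumCodes.QuantumExpander`.
Leverrier–Tillich–Zémor's quantum expander code `Q_G` of a bipartite graph `G = (A ∪ B, ℰ)` (check matrices
`expanderHX H`, `expanderHZ H` on the qubits `(A × A) ⊕ (B × B)`, `QuantumExpanderCodes.lean`) has minimum distance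
`> min(γ_A n_A, γ_B n_B)` whenever `G` is biregular and `(γ_A, δ_A, γ_B, δ_B)`-left-right-expanding with
`δ_A, δ_B < 1/2` — LTZ15 Corollary 5, PROVED in the tree (`QuantumExpander.min_lt_hammingNorm_of_isBiregular`,
`QuantumExpanderCodeParameters.lean`). This file draws the DECODING consequence for the whole family (the qec cell's Q4
«theorem column», family level): packaged as a check-matrix CSS code (`QuantumExpander.code H`, TZ Prop. 3 for the
commutation), EVERY minimum-weight sector decoder of `Q_G` — in particular the canonical `Decoder.minWeight` —
corrects every bit-flip pattern and every phase-flip pattern of weight `t` with `2t ≤ ⌊min(γ_A n_A, γ_B n_B)⌋`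
(Gottesman / Nielsen–Chuang: distance `≥ 2t + 1` ⇒ `t` errors corrected), an adversarial correction radius LINEAR in
the block length for an expander family.

Statements (all PROVED, no named facts):
* `code` (definition) with `code_HX` / `code_HZ`;
* `floor_succ_le_hammingNorm_xLogical` / `…_zLogical` — every `X`- resp. `Z`-logical of `code H` has weight
  `≥ ⌊min(γ_A n_A, γ_B n_B)⌋ + 1` (Cor. 5 in the `CSSCode` phrasing);
* `correctsUpToX_of_isMinWeight` / `correctsUpToZ_of_isMinWeight` — radius `≥ t` for every minimum-weight sector
  decoder when `2t ≤ ⌊min(γ_A n_A, γ_B n_B)⌋`;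
* `minWeight_correctsUpToX` / `minWeight_correctsUpToZ` — the canonical minimum-weight decoders.

WHAT THIS IS NOT: the EFFICIENT small-set-flip decoder of LTZ15 Theorem 2 / FGL18 Proposition 11 (a linear-time
algorithm correcting a smaller linear number of adversarial errors) — those are the statement-only named facts
`LTZ15_theorem2` / `FGL18_proposition11` of `QuantumExpanderCodes.lean`, untouched here; minimum-weight decoding is a
specified (inefficient) function. Nothing probabilistic (the expander thresholds are `QuantumExpanderCodeThresholds.lean`).
Axioms ⊆ {propext, Classical.choice, Quot.sound}.

## References
* [LeverrierTillichZemor2015] A. Leverrier, J.-P. Tillich, G. Zémor, *Quantum expander codes*, FOCS 2015 =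
  arXiv:1504.00822, Cor. 5 (arXiv v1 chunk p0008 L39-40: "If the graph G=(A∪B,ℰ) is (γ_A,δ_A,γ_B,δ_B)-left-right-
  expanding with δ_A,δ_B<1/2, then the minimum distance of the associated quantum code Q_G is at least …").
* [NielsenChuang2010] Nielsen–Chuang, §10.5.5 p. 467 ("a code with distance at least 2t+1 … is able to correct
  arbitrary errors on any t qubits").
* [FawziGrospellierLeverrier2018] O. Fawzi, A. Grospellier, A. Leverrier, FOCS 2018, §2.3 (the CSS pair H_X, H_Z of Q_G).
-/

namespace Literature.InformationTheory.QuantumCodes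

namespace QuantumExpander

open Finset Matrix

section Hamming

variable {ι M : Type*} [Fintype ι] [AddCommGroup M] [DecidableEq M]

/-- Hamming weight is invariant under negation (private plumbing). [folklore] -/
private theorem hammingNorm_neg_eq' (x : ι → M) : hammingNorm (-x) = hammingNorm x := by
  unfold hammingNorm
  congr 1
  ext i
  simp

/-- Hamming weight is subadditive (private plumbing). [folklore] -/
private theorem hammingNorm_add_le_add' (x y : ι → M) :
    hammingNorm (x + y) ≤ hammingNorm x + hammingNorm y := by
  have h := hammingDist_triangle x 0 (-y)
  rw [hammingDist_eq_hammingNorm, hammingDist_eq_hammingNorm, hammingDist_eq_hammingNorm,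
    neg_zero, zero_add, add_zero, hammingNorm_neg_eq', hammingNorm_neg_eq'] at h
  have h' : hammingNorm (-x + -y) = hammingNorm (x + y) := by
    rw [← neg_add_rev, hammingNorm_neg_eq', add_comm]
  omega

end Hamming

variable {A B : Type*} [Fintype A] [Fintype B] [DecidableEq A] [DecidableEq B]

/-- **The quantum expander code `Q_G` as a check-matrix CSS code**: `H^X = expanderHX H`, `H^Z = expanderHZ H` on the
qubits `(A × A) ⊕ (B × B)`, commutation `H_X H_Zᵀ = 0` (`expanderHX_mul_expanderHZ_transpose`). (definition)
[cite: FawziGrospellierLeverrier2018, §2.3 (H_X = (I ⊗ H, Hᵀ ⊗ I), H_Z = (H ⊗ I, I ⊗ Hᵀ), H_X H_Zᵀ = 0)] -/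
def code (H : Matrix B A (ZMod 2)) : CSSCode (A × B) (B × A) ((A × A) ⊕ (B × B)) :=
  CSSCode.ofMatrices (expanderHX H) (expanderHZ H) (expanderHX_mul_expanderHZ_transpose H)

/-- `H^X` of `code H` is `expanderHX H` (definitional). [cite: FawziGrospellierLeverrier2018, §2.3] -/
@[simp] theorem code_HX (H : Matrix B A (ZMod 2)) : (code H).HX = expanderHX H := rfl

/-- `H^Z` of `code H` is `expanderHZ H` (definitional). [cite: FawziGrospellierLeverrier2018, §2.3] -/
@[simp] theorem code_HZ (H : Matrix B A (ZMod 2)) : (code H).HZ = expanderHZ H := rfl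

/-- **LTZ15 Cor. 5, `X`-sector of the CSS code**: for a `(Δ_A, Δ_B)`-biregular (`Δ_A, Δ_B ≥ 1`),
`(γ_A, δ_A, γ_B, δ_B)`-left-right-expanding graph with `δ_A, δ_B < 1/2`, every `X`-logical of `Q_G` (`H^Z v = 0`,
`v ∉ rs H^X`) has weight `≥ ⌊min(γ_A n_A, γ_B n_B)⌋ + 1`. [cite: LeverrierTillichZemor2015, Cor. 5 (arXiv v1 p0008 L39-40)] -/
theorem floor_succ_le_hammingNorm_xLogical (H : Matrix B A (ZMod 2)) {dA dB : ℕ} {γA δA γB δB : ℝ}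
    (hreg : IsBiregular H dA dB) (hdA : 0 < dA) (hdB : 0 < dB)
    (hexp : IsLeftRightExpanding H dA dB γA δA γB δB) (hδA : δA < 1 / 2) (hδB : δB < 1 / 2)
    {v : (A × A) ⊕ (B × B) → ZMod 2} (hv : (code H).HZ *ᵥ v = 0) (hv' : v ∉ (code H).rowSpX) :
    ⌊min (γA * Fintype.card A) (γB * Fintype.card B)⌋₊ + 1 ≤ hammingNorm v := by
  have h := (floor_succ_le_cssMinDist H (fun a => (hreg.1 a).le) (fun b => (hreg.2 b).le) hdA hdB hexp hδA hδB).trans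
    (cssMinDist_le_hammingNorm (HX := expanderHX H) (HZ := expanderHZ H) (Or.inr ⟨hv, hv'⟩))
  exact_mod_cast h

/-- **LTZ15 Cor. 5, `Z`-sector of the CSS code**: every `Z`-logical of `Q_G` (`H^X v = 0`, `v ∉ rs H^Z`) has weight
`≥ ⌊min(γ_A n_A, γ_B n_B)⌋ + 1`. [cite: LeverrierTillichZemor2015, Cor. 5 (arXiv v1 p0008 L39-40)] -/
theorem floor_succ_le_hammingNorm_zLogical (H : Matrix B A (ZMod 2)) {dA dB : ℕ} {γA δA γB δB : ℝ}
    (hreg : IsBiregular H dA dB) (hdA : 0 < dA) (hdB : 0 < dB)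
    (hexp : IsLeftRightExpanding H dA dB γA δA γB δB) (hδA : δA < 1 / 2) (hδB : δB < 1 / 2)
    {v : (A × A) ⊕ (B × B) → ZMod 2} (hv : (code H).HX *ᵥ v = 0) (hv' : v ∉ (code H).rowSpZ) :
    ⌊min (γA * Fintype.card A) (γB * Fintype.card B)⌋₊ + 1 ≤ hammingNorm v := by
  have h := (floor_succ_le_cssMinDist H (fun a => (hreg.1 a).le) (fun b => (hreg.2 b).le) hdA hdB hexp hδA hδB).trans
    (cssMinDist_le_hammingNorm (HX := expanderHX H) (HZ := expanderHZ H) (Or.inl ⟨hv, hv'⟩))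
  exact_mod_cast h

/-- **Every minimum-weight `X`-decoder of a quantum expander code corrects every bit-flip pattern of weight `t` with
`2t ≤ ⌊min(γ_A n_A, γ_B n_B)⌋`** (biregular, left-right-expanding, `δ_A, δ_B < 1/2`): Cor. 5 gives distance `≥ 2t + 1`
in this sector, and a code of distance `≥ 2t+1` corrects `t` errors under minimum-weight decoding. (proved)
[cite: LeverrierTillichZemor2015, Cor. 5 (arXiv v1 p0008 L39-40)] [cite: NielsenChuang2010, §10.5.5 p. 467] -/
theorem correctsUpToX_of_isMinWeight (H : Matrix B A (ZMod 2)) {dA dB : ℕ} {γA δA γB δB : ℝ}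
    (hreg : IsBiregular H dA dB) (hdA : 0 < dA) (hdB : 0 < dB)
    (hexp : IsLeftRightExpanding H dA dB γA δA γB δB) (hδA : δA < 1 / 2) (hδB : δB < 1 / 2)
    {D : Decoder (B × A → ZMod 2) ((A × A) ⊕ (B × B) → ZMod 2)}
    (hD : D.IsMinWeight (code H).xSyndrome ((code H).kerZ : Set ((A × A) ⊕ (B × B) → ZMod 2)) hammingNorm)
    {t : ℕ} (ht : 2 * t ≤ ⌊min (γA * Fintype.card A) (γB * Fintype.card B)⌋₊) :
    D.CorrectsUpTo (code H).xSyndrome ((code H).rowSpX : Set ((A × A) ⊕ (B × B) → ZMod 2)) hammingNorm t :=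
  hD.correctsUpTo hammingNorm_add_le_add'
    (fun _ hv hv' => floor_succ_le_hammingNorm_xLogical H hreg hdA hdB hexp hδA hδB hv hv') (by omega)

/-- **Every minimum-weight `Z`-decoder of a quantum expander code corrects every phase-flip pattern of weight `t` with
`2t ≤ ⌊min(γ_A n_A, γ_B n_B)⌋`.** (proved)
[cite: LeverrierTillichZemor2015, Cor. 5 (arXiv v1 p0008 L39-40)] [cite: NielsenChuang2010, §10.5.5 p. 467] -/
theorem correctsUpToZ_of_isMinWeight (H : Matrix B A (ZMod 2)) {dA dB : ℕ} {γA δA γB δB : ℝ}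
    (hreg : IsBiregular H dA dB) (hdA : 0 < dA) (hdB : 0 < dB)
    (hexp : IsLeftRightExpanding H dA dB γA δA γB δB) (hδA : δA < 1 / 2) (hδB : δB < 1 / 2)
    {D : Decoder (A × B → ZMod 2) ((A × A) ⊕ (B × B) → ZMod 2)}
    (hD : D.IsMinWeight (code H).zSyndrome ((code H).kerX : Set ((A × A) ⊕ (B × B) → ZMod 2)) hammingNorm)
    {t : ℕ} (ht : 2 * t ≤ ⌊min (γA * Fintype.card A) (γB * Fintype.card B)⌋₊) :
    D.CorrectsUpTo (code H).zSyndrome ((code H).rowSpZ : Set ((A × A) ⊕ (B × B) → ZMod 2)) hammingNorm t :=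
  hD.correctsUpTo hammingNorm_add_le_add'
    (fun _ hv hv' => floor_succ_le_hammingNorm_zLogical H hreg hdA hdB hexp hδA hδB hv hv') (by omega)

/-- **The canonical minimum-weight `X`-decoder of `Q_G` corrects `t` bit flips whenever `2t ≤ ⌊min(γ_A n_A, γ_B n_B)⌋`.**
(proved) [cite: LeverrierTillichZemor2015, Cor. 5 (arXiv v1 p0008 L39-40)] [cite: NielsenChuang2010, §10.5.5 p. 467] -/
theorem minWeight_correctsUpToX (H : Matrix B A (ZMod 2)) {dA dB : ℕ} {γA δA γB δB : ℝ}
    (hreg : IsBiregular H dA dB) (hdA : 0 < dA) (hdB : 0 < dB)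
    (hexp : IsLeftRightExpanding H dA dB γA δA γB δB) (hδA : δA < 1 / 2) (hδB : δB < 1 / 2)
    {t : ℕ} (ht : 2 * t ≤ ⌊min (γA * Fintype.card A) (γB * Fintype.card B)⌋₊) :
    (Decoder.minWeight (code H).xSyndrome hammingNorm).CorrectsUpTo (code H).xSyndrome
      ((code H).rowSpX : Set ((A × A) ⊕ (B × B) → ZMod 2)) hammingNorm t :=
  correctsUpToX_of_isMinWeight H hreg hdA hdB hexp hδA hδB (code H).isMinWeight_minWeight_xSyndrome ht

/-- **The canonical minimum-weight `Z`-decoder of `Q_G` corrects `t` phase flips whenever `2t ≤ ⌊min(γ_A n_A, γ_B n_B)⌋`.**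
(proved) [cite: LeverrierTillichZemor2015, Cor. 5 (arXiv v1 p0008 L39-40)] [cite: NielsenChuang2010, §10.5.5 p. 467] -/
theorem minWeight_correctsUpToZ (H : Matrix B A (ZMod 2)) {dA dB : ℕ} {γA δA γB δB : ℝ}
    (hreg : IsBiregular H dA dB) (hdA : 0 < dA) (hdB : 0 < dB)
    (hexp : IsLeftRightExpanding H dA dB γA δA γB δB) (hδA : δA < 1 / 2) (hδB : δB < 1 / 2)
    {t : ℕ} (ht : 2 * t ≤ ⌊min (γA * Fintype.card A) (γB * Fintype.card B)⌋₊) :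
    (Decoder.minWeight (code H).zSyndrome hammingNorm).CorrectsUpTo (code H).zSyndrome
      ((code H).rowSpZ : Set ((A × A) ⊕ (B × B) → ZMod 2)) hammingNorm t :=
  correctsUpToZ_of_isMinWeight H hreg hdA hdB hexp hδA hδB (code H).isMinWeight_minWeight_zSyndrome ht

end QuantumExpander

end Literature.InformationTheory.QuantumCodes
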